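import Literature.Analysis.FluidPDE.HardSphereCollisionRecord
import Literature.Analysis.FluidPDE.HardSphereShortTime
import HarnessLib

/-!
# Hit-piece dynamics along a hard-sphere flow: the predicted collision is in the window

Topic `Literature/MathematicalPhysics/KineticTheory`. Input of the FIRST-COLLISION LOWER BOUND in the
discharge of the stationary collision-rate identity `HardSphereCampbellFormula`
(`HardSphereCollisionCampbell`, Cercignani–Illner–Pulvirenti 1994 App. 4.A: the special-flow
representation of the Liouville measure over the collision hypersurface).

WHAT. Fix the diameter `0 < ε`, a speed bound `V ≥ 0`, a window `δ ≥ 0` and an interaction length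
`r ≥ 2Vδ` with `ε + 2r < 1/2`, and an ordered pair `a < b`. On the *hit piece*
`Alexander.hitPiece N ε r δ a b` of Gallagher–Saint-Raymond–Texier (proof of Prop. 4.1.1, p. 19:
"exactly one pair interacts during `[0, δ]`", minus the grazing set) intersected with the energy
shell `E ≤ V²/2`, the collision-by-collision algorithm predicts ONE collision in the window: the pair
`(a, b)` hits at the time `τ₀ = pairHitTime ε (x_a - x_b) (v_a - v_b) ∈ (0, δ]`, with post-collisional
state `w⁺ = C_{ab} (S_{τ₀} u)` (`Alexander.HitHyp.stateAfter_one`). For an ARBITRARY hard-sphere flow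
structure `Φ` on the torus and a GOOD datum `u` of `Φ` in that piece, the orbit `s ↦ Φ_s u` is a
hard-sphere trajectory, hence reproduces the algorithmic orbit
(`IsHardSphereTrajectory.stateAfter_eq_apply`): `Φ_{τ₀} u = w⁺` and `τ₀` is a collision time of the
orbit, at which the ordered contact pairs contain `(a, b)` and `(b, a)`
(`campbell_flow_pairHitTime_eq`, `campbell_pairHitTime_mem_collisionTimes`,
`campbell_mem_contactPairs_flow_pairHitTime`). Consequently, marks being `≥ 0`, the marked collision
sum of the orbit over the window `(0, δ]` dominates the two marks of that collision:
`g w⁺ a b + g w⁺ b a ≤ Φ.collisionPairSum (0, δ] g u` (`collisionPairSum_ge_of_mem_hitPiece`).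
Integrated over the hit piece and summed over windows (stationarity) this is the lower bound
`τ · flux ≤ ∫ Σ_{collisions in (0,τ]} g` of the Campbell identity.

NOT here: the measure of the hit piece, the change of variables to collision coordinates, the
window bookkeeping (sibling files of the discharge).

## References

* [CIP1994] C. Cercignani, R. Illner, M. Pulvirenti, *The Mathematical Theory of Dilute Gases*,
  Applied Math. Sciences 106, Springer (1994), App. 4.A pp. 107–111, §4.2.
* [GST2013] I. Gallagher, L. Saint-Raymond, B. Texier, *From Newton to Boltzmann: hard spheres and
  short-range potentials*, EMS (2013), arXiv:1208.5753, §4.1, proof of Prop. 4.1.1 (p. 19).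
-/

open MeasureTheory Set Function Filter Metric
open scoped ENNReal NNReal RealInnerProductSpace

namespace Literature.MathematicalPhysics.KineticTheory

open Literature.Analysis.FluidPDE

noncomputable section

variable {d : Type*} [Fintype d] {N : ℕ} {ε : ℝ}

/-- **The orbit of a good datum of a hit piece at the hitting time is the post-collisional state**:
under the standing hypotheses `Alexander.HitHyp ε r δ V u a b` of the one-collision analysis, for a
good datum `u` of a hard-sphere flow `Φ` on the torus,
`Φ_{τ₀} u = C_{ab} (S_{τ₀} u)` with `τ₀ = pairHitTime ε (x_a - x_b) (v_a - v_b)` (the orbit is a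
hard-sphere trajectory starting at `u`, so its value at the first algorithmic instant
`t₁ = τ(u) = τ₀` is the first post-collisional state, `IsHardSphereTrajectory.stateAfter_eq_apply`,
`Alexander.HitHyp.stateAfter_one`). [folklore] -/
theorem campbell_flow_pairHitTime_eq {r δ V : ℝ} (Φ : HardSphereFlow (Torus.geometry d) ε N)
    {a b : Fin N} {u : Config N d (UnitAddTorus d)} (hu : u ∈ Φ.good)
    (h : Alexander.HitHyp ε r δ V u a b) :
    Φ.flow (pairHitTime ε ((Torus.geometry d).sepVec (u a).1 (u b).1) ((u a).2 - (u b).2)) u =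
      collidePair (Torus.geometry d) a b (freeFlight (Torus.geometry d)
        (pairHitTime ε ((Torus.geometry d).sepVec (u a).1 (u b).1) ((u a).2 - (u b).2)) u) := by
  have hG := Torus.isHardSphereRegular_geometry (d := d) h.ε_lt
  have hγ : IsHardSphereTrajectory (Torus.geometry d) ε N fun s => Φ.flow s u := Φ.isTrajectory u hu
  have h0 : Φ.flow 0 u = u := Φ.flow_zero u hu
  have hfin : Alexander.collisionInstant (Torus.geometry d) ε ((fun s => Φ.flow s u) 0) 1 ≠ ∞ := by
    show Alexander.collisionInstant (Torus.geometry d) ε (Φ.flow 0 u) 1 ≠ ∞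
    rw [h0, Alexander.collisionInstant_one]
    exact h.freeExitTime_ne_top
  obtain ⟨hk, -⟩ := hγ.stateAfter_eq_apply hG hfin
  rw [h0, Alexander.collisionInstant_one, h.toReal_freeExitTime, h.stateAfter_one] at hk
  exact hk.symm

/-- **At the hitting time the ordered contact pairs of the orbit contain `(a, b)`** (the positions of
the post-collisional state are those of `S_{τ₀} u`, which is in the contact set of `(a, b)`,
`Alexander.HitHyp.freeFlight_hitTime_mem_contactSet`). [folklore] -/
theorem campbell_mem_contactPairs_flow_pairHitTime {r δ V : ℝ}
    (Φ : HardSphereFlow (Torus.geometry d) ε N) {a b : Fin N} {u : Config N d (UnitAddTorus d)}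
    (hu : u ∈ Φ.good) (h : Alexander.HitHyp ε r δ V u a b) :
    (a, b) ∈ contactPairs (Torus.geometry d) ε
      (Φ.flow (pairHitTime ε ((Torus.geometry d).sepVec (u a).1 (u b).1) ((u a).2 - (u b).2)) u) := by
  rw [campbell_flow_pairHitTime_eq Φ hu h, contactPairs_collidePair]
  exact mem_contactPairs.2 ⟨h.ne, h.freeFlight_hitTime_mem_contactSet⟩

/-- The same for the reversed pair `(b, a)` (contact is symmetric in the regular torus geometry,
`swap_mem_contactPairs_iff`). [folklore] -/
theorem campbell_swap_mem_contactPairs_flow_pairHitTime {r δ V : ℝ}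
    (Φ : HardSphereFlow (Torus.geometry d) ε N) {a b : Fin N} {u : Config N d (UnitAddTorus d)}
    (hu : u ∈ Φ.good) (h : Alexander.HitHyp ε r δ V u a b) :
    (b, a) ∈ contactPairs (Torus.geometry d) ε
      (Φ.flow (pairHitTime ε ((Torus.geometry d).sepVec (u a).1 (u b).1) ((u a).2 - (u b).2)) u) :=
  (swap_mem_contactPairs_iff (Torus.isHardSphereRegular_geometry (d := d) h.ε_lt) (p := (a, b))).2
    (campbell_mem_contactPairs_flow_pairHitTime Φ hu h)

/-- **The hitting time is a collision time of the orbit in the window `(0, δ]`.** [folklore] -/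
theorem campbell_pairHitTime_mem_collisionTimes {r δ V : ℝ}
    (Φ : HardSphereFlow (Torus.geometry d) ε N) {a b : Fin N} {u : Config N d (UnitAddTorus d)}
    (hu : u ∈ Φ.good) (h : Alexander.HitHyp ε r δ V u a b) :
    pairHitTime ε ((Torus.geometry d).sepVec (u a).1 (u b).1) ((u a).2 - (u b).2) ∈
      collisionTimes (Torus.geometry d) ε (fun s => Φ.flow s u) ∩ Ioc 0 δ :=
  ⟨mem_collisionTimes_of_mem_contactPairs (γ := fun s => Φ.flow s u)
      (campbell_mem_contactPairs_flow_pairHitTime Φ hu h),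
    h.hitTime_pos, h.hitTime_le⟩

/-- **On a hit piece the marked collision sum over the window dominates the marks of the predicted
collision** (GST 2013, proof of Prop. 4.1.1 p. 19, read along an arbitrary hard-sphere flow
structure `Φ` on `T^d`): for `0 < ε`, `ε + 2r < 1/2`, `2Vδ ≤ r`, `V, δ ≥ 0`, `a < b`, a good datum
`u ∈ Φ.good` in `Alexander.hitPiece N ε r δ a b` with `E(u) ≤ V²/2`, and any mark
`g ≥ 0` of (configuration, ordered pair), writing `τ₀ = pairHitTime ε (x_a - x_b) (v_a - v_b)` and
`w⁺ = C_{ab} (S_{τ₀} u)` for the post-collisional configuration,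
`g w⁺ a b + g w⁺ b a ≤ Φ.collisionPairSum (Ioc 0 δ) g u`: the window `(0, δ]` contains the collision
time `τ₀` of the orbit, at which `Φ_{τ₀} u = w⁺` has the ordered contact pairs `(a, b)` and
`(b, a)`, and all other terms of the (finite) collision pair sum are `≥ 0`.
[cite: GST2013, proof of Prop. 4.1.1 p. 19] -/
theorem collisionPairSum_ge_of_mem_hitPiece {r δ V : ℝ} (hε : 0 < ε) (hch : ε + 2 * r < 2⁻¹)
    (hr : 2 * V * δ ≤ r) (hV : 0 ≤ V) (hδ : 0 ≤ δ)
    (Φ : HardSphereFlow (Torus.geometry d) ε N) {a b : Fin N} (hab : a < b)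
    {u : Config N d (UnitAddTorus d)} (hu : u ∈ Φ.good)
    (hmem : u ∈ Alexander.hitPiece N ε r δ a b) (hE : configEnergy u ≤ V ^ 2 / 2)
    (g : Config N d (UnitAddTorus d) → Fin N → Fin N → ℝ≥0∞) :
    g (collidePair (Torus.geometry d) a b (freeFlight (Torus.geometry d)
        (pairHitTime ε ((Torus.geometry d).sepVec (u a).1 (u b).1) ((u a).2 - (u b).2)) u)) a b +
      g (collidePair (Torus.geometry d) a b (freeFlight (Torus.geometry d)
        (pairHitTime ε ((Torus.geometry d).sepVec (u a).1 (u b).1) ((u a).2 - (u b).2)) u)) b a ≤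
      Φ.collisionPairSum (Ioc 0 δ) (fun _ w i j => g w i j) u := by
  have _ := hδ -- implied by the hit piece (`0 < τ₀ ≤ δ`); kept for the registered signature
  have h : Alexander.HitHyp ε r δ V u a b := ⟨hε, hch, hr, hV, hE, hab, hmem⟩
  have hfin := Φ.finite_collisionTimes_inter hu (Ioc_subset_Icc_self : Ioc (0 : ℝ) δ ⊆ Icc 0 δ)
  have hpa := campbell_mem_contactPairs_flow_pairHitTime Φ hu h
  have hpb := campbell_swap_mem_contactPairs_flow_pairHitTime Φ hu h
  have hτ : pairHitTime ε ((Torus.geometry d).sepVec (u a).1 (u b).1) ((u a).2 - (u b).2) ∈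
      hfin.toFinset :=
    (Set.Finite.mem_toFinset hfin).2 (campbell_pairHitTime_mem_collisionTimes Φ hu h)
  have hne : ((a, b) : Fin N × Fin N) ≠ (b, a) := fun heq => h.ne (Prod.mk.inj heq).1
  unfold HardSphereFlow.collisionPairSum
  rw [collisionPairSum_eq_finset_sum hfin, ← campbell_flow_pairHitTime_eq Φ hu h]
  calc g (Φ.flow (pairHitTime ε ((Torus.geometry d).sepVec (u a).1 (u b).1) ((u a).2 - (u b).2)) u)
          a b +
        g (Φ.flow (pairHitTime ε ((Torus.geometry d).sepVec (u a).1 (u b).1) ((u a).2 - (u b).2)) u)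
          b a
      = ∑ p ∈ ({(a, b), (b, a)} : Finset (Fin N × Fin N)),
          g (Φ.flow (pairHitTime ε ((Torus.geometry d).sepVec (u a).1 (u b).1)
            ((u a).2 - (u b).2)) u) p.1 p.2 := by
        rw [Finset.sum_pair hne]
    _ ≤ ∑ p ∈ contactPairs (Torus.geometry d) ε
          (Φ.flow (pairHitTime ε ((Torus.geometry d).sepVec (u a).1 (u b).1) ((u a).2 - (u b).2)) u),
          g (Φ.flow (pairHitTime ε ((Torus.geometry d).sepVec (u a).1 (u b).1)
            ((u a).2 - (u b).2)) u) p.1 p.2 := by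
        refine Finset.sum_le_sum_of_subset fun p hp => ?_
        simp only [Finset.mem_insert, Finset.mem_singleton] at hp
        rcases hp with rfl | rfl
        exacts [hpa, hpb]
    _ ≤ ∑ t ∈ hfin.toFinset, ∑ p ∈ contactPairs (Torus.geometry d) ε (Φ.flow t u),
          g (Φ.flow t u) p.1 p.2 :=
        Finset.single_le_sum
          (f := fun t => ∑ p ∈ contactPairs (Torus.geometry d) ε (Φ.flow t u), g (Φ.flow t u) p.1 p.2)
          (fun _ _ => zero_le) hτ

end

end Literature.MathematicalPhysics.KineticTheory
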